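import Summits.KontsevichZagierPeriods.Zeta5Search.RVFlatGauge
import Mathlib.Data.Fin.Tuple.Sort
import HarnessLib
import HarnessLib.Audit

/-!
# ζ(5) search — structure of the FLAT `S₇`-gauge law: `d ≤ 3·m₅`, hence "flat = (28) + at most ONE unit" (fam-rv gen-4, part 2)

HONEST FRAMING: systematic search; no irrationality claim unless certified.

Cell `pub-zeta5`, family-designer seat `pub-zeta5-fam-rv-g4` (Rhin–Viola permutation-group refinements, gen 4,
2026-08-20).  Staged at `HOME/pub-zeta5-fam-rv/gen4/lean/RVFlatGaugeStructure.lean`; proposed tree target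
`Summits/KontsevichZagierPeriods/Zeta5Search/RVFlatGaugeStructure.lean` (filing by a permitted lane, AFTER
`RVFlatGauge.lean` = p239743 lands; planner seats have no Zeta5Search stage permission).

WHAT THIS FILE IS.  `RVFlatGauge.lean` types the cone-free `S₇`-gauge law (FLAT): Brown–Zudilin's `D = d_{m₁}⋯d_{m₅}`
with fifth modulus `m₅♭ = max(m₅, ⌊d/2⌋)`, `d = 3b₀ − Σbᵢ` the 29th invariant form.  This file PROVES the structure
theorem behind the observed "margin exactly −1" of every off-cone failure of (28)/v2:

  `dOf_le_three_mul_m5 : InPolytope b → d(b) ≤ 3·m₅(b)`   (sharp: `b = (b₀; 0,…,0)` gives `d = 3b₀ = 3m₅`),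

so `m₅♭ ≤ 3m₅/2 < 2m₅` and `eDflat_le_eD_add_one : e_D♭(b,p) ≤ e_D(b,p) + 1` at every prime: the flat modulus never
charges more than ONE unit over `D` — there is no higher-digit content in (FLAT), and (FLAT-28) implies the cone-free
ONE-UNIT weakening of (28), `OneUnitGaugeLaw28` (`p · d_{m₁}⋯d_{m₅} · ρ(b)·Cas_j(b) ∈ ℤ_(p)` for all polytope `b`,
`p ≥ 5`), PROVED implication `oneUnitGaugeLaw28_of_flatGaugeLaw28`.  Proof of `d ≤ 3m₅`: sort the lower parameters
`c₁ ≤ … ≤ c₇` by an element of `S₇` (`Tuple.sort`; `d`, `m₅` are `S₇`-invariant, `gaugeDataPermInvariant_holds`); the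
five pair forms on `{c₁,…,c₄}` other than `(c₃,c₄)` are `≥ b₀ − c₂ − c₄`, so `m₅ ≥ b₀ − c₂ − c₄` (order statistics
`le_m5_of_five_le_countP`), while `Σcᵢ ≥ 3c₂ + 3c₄`.

PROVED HERE (0 sorries): everything except the conjecture node `OneUnitGaugeLaw28` (MINTED BY THIS CELL, OBSERVED —
fam-rv gen-4: 1,132/1,132 recorded (28)/v2 failures have margin exactly −1; gen-2 g9: 28/28; census g13: min margin −1),
which is a PROVED consequence of `RVFlatGauge.FlatGaugeLaw28`.  Evidence and numbers: `HOME/families/rv/FAMILY.md` §14.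
-/

namespace Summit.KontsevichZagierPeriods.Zeta5Search.RVFlatGauge

open Finset
open Summit.KontsevichZagierPeriods.Zeta5Search.CasoratianValuation (casoratian shift InPolytope)
open Summit.KontsevichZagierPeriods.Zeta5Search.WedgeDictionary (dOf)
open Summit.KontsevichZagierPeriods.Zeta5Search.SymmetricGauge

/-! ### PROVED: `d ≤ 3·m₅` on the polytope — the flat law charges AT MOST ONE extra unit over `D`

The 29th form is controlled by the 28: for `b` in the polytope, `d(b) ≤ 3·m₅(b)` (sharp: `b = (b₀; 0,…,0)` has
`d = 3b₀ = 3m₅`; exhaustive check `b₀ ≤ 16`: `sup d/(2m₅) = 3/2`).  Proof: sort the lower parameters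
`c₁ ≤ … ≤ c₇` by an element of `S₇` (`Tuple.sort`; `d`, `m₅` are `S₇`-invariant); the five pair forms on
`{c₁,c₂,c₃,c₄} ∖ {(c₃,c₄)}` are all `≥ b₀ − c₂ − c₄`, so `m₅ ≥ b₀ − c₂ − c₄`, and `Σcᵢ ≥ 3c₂ + 3c₄` since
`c₁ ≥ 0`, `c₃ ≥ c₂`, `c₅, c₆, c₇ ≥ c₄`.  CONSEQUENCE (`eDflat_le_eD_add_one`): `m₅♭ ≤ 3m₅/2 < 2m₅`, so
`⌊log_p m₅♭⌋ ≤ ⌊log_p m₅⌋ + 1` at every prime: (FLAT) = "v2 plus at most one unit", with the unit located at the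
primes `p` with `m₅ < p ≤ d/2` or `p ≤ m₅ < p^{k} ≤ ⌊d/2⌋` — there is no higher-digit content in the flat modulus. -/

/-- Order statistics: if at least five entries of a `≥`-sorted list are `≥ x`, its entry no. 4 is `≥ x`. -/
theorem le_getD_four_of_pairwise {s : List ℤ} {x : ℤ} (hsort : s.Pairwise (· ≥ ·))
    (hc : 5 ≤ s.countP (fun y => decide (x ≤ y))) : x ≤ s.getD 4 0 := by
  rcases s with _ | ⟨a₀, _ | ⟨a₁, _ | ⟨a₂, _ | ⟨a₃, _ | ⟨a₄, t⟩⟩⟩⟩⟩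
  · simp at hc
  · exact absurd (le_trans hc List.countP_le_length) (by simp)
  · exact absurd (le_trans hc List.countP_le_length) (by simp)
  · exact absurd (le_trans hc List.countP_le_length) (by simp)
  · exact absurd (le_trans hc List.countP_le_length) (by simp)
  · show x ≤ a₄
    by_contra hlt'
    have hlt : a₄ < x := not_le.mp hlt'
    have h4 : ∀ y ∈ t, a₄ ≥ y := by
      simp only [List.pairwise_cons] at hsort
      exact hsort.2.2.2.2.1
    have ht0 : t.countP (fun y => decide (x ≤ y)) = 0 :=
      List.countP_eq_zero.2 fun y hy => by have := h4 y hy; simp; omega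
    simp only [List.countP_cons, ht0, decide_eq_true_eq] at hc
    split_ifs at hc <;> omega

/-- … hence for any list: five entries `≥ x` force the fifth largest `≥ x`. -/
theorem le_m5_of_five_le_countP {l : List ℤ} {x : ℤ} (h : 5 ≤ l.countP (fun y => decide (x ≤ y))) :
    x ≤ (l.insertionSort (· ≥ ·)).getD 4 0 :=
  le_getD_four_of_pairwise (List.pairwise_insertionSort _ l)
    (by rwa [(List.perm_insertionSort (· ≥ ·) l).countP_eq])

/-- The 28 forms as an explicit list. -/
theorem forms28_eq (b : ℕ → ℤ) : forms28 b =
    [b 1, b 2, b 3, b 4, b 5, b 6, b 7,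
     b 0 - b 1 - b 2, b 0 - b 1 - b 3, b 0 - b 1 - b 4, b 0 - b 1 - b 5, b 0 - b 1 - b 6, b 0 - b 1 - b 7,
     b 0 - b 2 - b 3, b 0 - b 2 - b 4, b 0 - b 2 - b 5, b 0 - b 2 - b 6, b 0 - b 2 - b 7,
     b 0 - b 3 - b 4, b 0 - b 3 - b 5, b 0 - b 3 - b 6, b 0 - b 3 - b 7,
     b 0 - b 4 - b 5, b 0 - b 4 - b 6, b 0 - b 4 - b 7,
     b 0 - b 5 - b 6, b 0 - b 5 - b 7,
     b 0 - b 6 - b 7] := by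
  simp [forms28, List.range, List.range.loop, List.flatMap]

/-- Five pair forms supported on the first four lower parameters, as a sublist of the 28. -/
theorem five_sublist_forms28 (b : ℕ → ℤ) :
    [b 0 - b 1 - b 2, b 0 - b 1 - b 3, b 0 - b 1 - b 4, b 0 - b 2 - b 3, b 0 - b 2 - b 4].Sublist (forms28 b) := by
  rw [forms28_eq]
  repeat (first | exact List.nil_sublist _ | apply List.Sublist.cons_cons | apply List.Sublist.cons)

/-- If those five forms are `≥ x` then at least five of the 28 are. -/
theorem five_le_countP_forms28 (b : ℕ → ℤ) (x : ℤ) (h12 : x ≤ b 0 - b 1 - b 2) (h13 : x ≤ b 0 - b 1 - b 3)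
    (h14 : x ≤ b 0 - b 1 - b 4) (h23 : x ≤ b 0 - b 2 - b 3) (h24 : x ≤ b 0 - b 2 - b 4) :
    5 ≤ (forms28 b).countP (fun y => decide (x ≤ y)) := by
  have h5 : [b 0 - b 1 - b 2, b 0 - b 1 - b 3, b 0 - b 1 - b 4, b 0 - b 2 - b 3, b 0 - b 2 - b 4].countP
      (fun y => decide (x ≤ y)) = 5 := by
    simp [h12, h13, h14, h23, h24]
  rw [← h5]; exact (five_sublist_forms28 b).countP_le

/-- `d ≤ 3m₅` when the lower parameters are sorted increasingly (and `b₁ ≥ 0`). -/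
theorem dOf_le_three_mul_m5_of_sorted (b : ℕ → ℤ) (h1 : 0 ≤ b 1) (h12 : b 1 ≤ b 2) (h23 : b 2 ≤ b 3)
    (h34 : b 3 ≤ b 4) (h45 : b 4 ≤ b 5) (h56 : b 5 ≤ b 6) (h67 : b 6 ≤ b 7) : dOf b ≤ 3 * m5 b := by
  have hx : b 0 - b 2 - b 4 ≤ m5 b := by
    unfold m5
    exact le_m5_of_five_le_countP
      (five_le_countP_forms28 b (b 0 - b 2 - b 4) (by omega) (by omega) (by omega) (by omega) (by omega))
  have hd : dOf b = 3 * b 0 - (b 1 + b 2 + b 3 + b 4 + b 5 + b 6 + b 7) := by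
    simp [dOf, Finset.sum_range_succ]
  omega

/-- **`d(b) ≤ 3·m₅(b)` on the polytope** (sorting by `S₇` + invariance of `d`, `m₅`). -/
theorem dOf_le_three_mul_m5 {b : ℕ → ℤ} (hb : InPolytope b) : dOf b ≤ 3 * m5 b := by
  let f : Fin 7 → ℤ := fun i => b (i.val + 1)
  let σ : Equiv.Perm (Fin 7) := Tuple.sort f
  have hmono : Monotone (f ∘ σ) := Tuple.monotone_sort f
  obtain ⟨hP, hd, _, hm5, _⟩ := gaugeDataPermInvariant_holds b σ
  have hle : ∀ (i j : ℕ) (hi : i < 7) (hj : j < 7), i ≤ j → permLower σ b (i + 1) ≤ permLower σ b (j + 1) := by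
    intro i j hi hj hij
    have h1 := permLower_apply_succ σ b ⟨i, hi⟩
    have h2 := permLower_apply_succ σ b ⟨j, hj⟩
    rw [h1, h2]
    exact hmono (Fin.mk_le_mk.2 hij)
  have h0 : 0 ≤ permLower σ b 1 := by
    obtain ⟨⟨_, hbox⟩, _, _⟩ := hP hb
    exact (hbox 0 (by simp)).1
  rw [← hd, ← hm5]
  exact dOf_le_three_mul_m5_of_sorted (permLower σ b) h0
    (hle 0 1 (by norm_num) (by norm_num) (by norm_num)) (hle 1 2 (by norm_num) (by norm_num) (by norm_num))
    (hle 2 3 (by norm_num) (by norm_num) (by norm_num)) (hle 3 4 (by norm_num) (by norm_num) (by norm_num))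
    (hle 4 5 (by norm_num) (by norm_num) (by norm_num)) (hle 5 6 (by norm_num) (by norm_num) (by norm_num))

/-- `m₅ ≥ 0` on the polytope (all 28 forms are `≥ 0` there; five of them suffice). -/
theorem m5_nonneg {b : ℕ → ℤ} (hb : InPolytope b) : 0 ≤ m5 b := by
  obtain ⟨⟨_, hbox⟩, hhalf, _⟩ := hb
  have h1 := hhalf 0 (by simp); have h2 := hhalf 1 (by simp); have h3 := hhalf 2 (by simp); have h4 := hhalf 3 (by simp)
  have g1 := (hbox 0 (by simp)).1; have g2 := (hbox 1 (by simp)).1; have g3 := (hbox 2 (by simp)).1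
  have g4 := (hbox 3 (by simp)).1
  simp only [zero_add, Nat.reduceAdd] at h1 h2 h3 h4 g1 g2 g3 g4
  unfold m5
  exact le_m5_of_five_le_countP
    (five_le_countP_forms28 b 0 (by omega) (by omega) (by omega) (by omega) (by omega))

/-- `2·m₅♭ ≤ max(2m₅, d) ≤ 3m₅` on the polytope. -/
theorem two_mul_m5flat_le {b : ℕ → ℤ} (hb : InPolytope b) : 2 * m5flat b ≤ 3 * m5 b := by
  have := dOf_le_three_mul_m5 hb
  have h0 := m5_nonneg hb
  unfold m5flat
  rcases le_total (m5 b) (dOf b / 2) with h | h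
  · rw [max_eq_right h]; omega
  · rw [max_eq_left h]; omega

/-- **The flat law charges at most ONE unit more than Brown–Zudilin's `D`:** `e_D♭ ≤ e_D + 1` on the polytope
(at every prime `p ≥ 2`, since `m₅♭ ≤ 3m₅/2 < p·m₅`). -/
theorem eDflat_le_eD_add_one {b : ℕ → ℤ} (hb : InPolytope b) {p : ℕ} (hp : 2 ≤ p) :
    eDflat b p ≤ eD b p + 1 := by
  have h3 := two_mul_m5flat_le hb
  have hm := m5_le_m5flat b
  have key : Nat.log p (m5flat b).toNat ≤ Nat.log p (m5 b).toNat + 1 := by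
    rcases le_or_gt (m5flat b) 0 with hz | hpos
    · rw [Int.toNat_of_nonpos hz, Nat.log_zero_right]; omega
    · have hm5pos : 0 < m5 b := by omega
      have hlt : ((m5flat b).toNat : ℤ) ≤ ((m5 b).toNat : ℤ) * (p : ℤ) := by
        rw [Int.toNat_of_nonneg hpos.le, Int.toNat_of_nonneg hm5pos.le]; nlinarith
      have hle' : (m5flat b).toNat ≤ (m5 b).toNat * p := by exact_mod_cast hlt
      calc Nat.log p (m5flat b).toNat ≤ Nat.log p ((m5 b).toNat * p) := Nat.log_mono_right hle'
        _ = Nat.log p (m5 b).toNat + 1 := Nat.log_mul_base (by omega) (by omega)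
  unfold eDflat; omega

/-! ### The cone-free ONE-UNIT weakening of (28) — implied by (FLAT-28) -/

/-- **(ONE-UNIT-28), OBSERVED (implied by FLAT-28, `oneUnitGaugeLaw28_of_flatGaugeLaw28`):** off the cone Brown–Zudilin's
(28)/v2 fails by AT MOST ONE unit — `v_p(Cas_j(b)) ≥ −(e_D(b,p) + 1) − v_p(ρ(b))`, i.e. `p · d_{m₁}⋯d_{m₅} · P ∈ ℤ_(p)`, for
every `b` in the polytope and every `p ≥ 5` (fam-rv gen-4: all 1,132 recorded (28)/v2 failures have margin exactly −1;
gen-2 g9: 28/28; census g13: min margin −1).  HONEST FRAMING: minted by this cell, not a published result. -/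
@[conjecture] def OneUnitGaugeLaw28 : Prop :=
  ∀ (b : ℕ → ℤ) (j p : ℕ),
    InPolytope b → 1 ≤ j → j ≤ 7 → InPolytope (shift b j) →
    p.Prime → 5 ≤ p → casoratian b j ≠ 0 →
      -(eD b p + 1) - padicValRat p (rhoB b) ≤ padicValRat p (casoratian b j)

/-- **`FlatGaugeLaw28 → OneUnitGaugeLaw28`** (by `e_D♭ ≤ e_D + 1`, i.e. by `d ≤ 3m₅`). -/
theorem oneUnitGaugeLaw28_of_flatGaugeLaw28 (h : FlatGaugeLaw28) : OneUnitGaugeLaw28 := by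
  intro b j p hb hj1 hj7 hb' hp h5 hne
  have key := h b j p hb hj1 hj7 hb' hp h5 hne
  have hle := eDflat_le_eD_add_one hb (p := p) (by omega)
  omega

/-- Instance: at the extremal shape `b = (b₀; 0,…,0)` the bound `d ≤ 3m₅` is attained (`b₀ = 10`). -/
example : dOf (fun i => if i = 0 then (10 : ℤ) else 0) = 30 ∧ m5 (fun i => if i = 0 then (10 : ℤ) else 0) = 10 := by
  decide

end Summit.KontsevichZagierPeriods.Zeta5Search.RVFlatGauge
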